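import Literature.AlgebraicGeometry.Modules.LocallyFreeTorsionFree
import Literature.AlgebraicGeometry.Modules.FlatSectionsRegular
import Literature.AlgebraicGeometry.Modules.VectorBundleFiniteLocallyFree
import Literature.AlgebraicGeometry.Crystalline.HodgeSheavesTorsionFree
import Mathlib.AlgebraicGeometry.Morphisms.Smooth
import HarnessLib

/-!
# `𝒪_X`, `Ω¹_{X/k}` and the Hodge sheaves `Ωᵃ_{X/k}` of a smooth `X/k` have no more torsion than `k`

Let `X → Spec k` be smooth of relative dimension `d` (`k` any commutative ring). The Hodge sheaves
`Ωᵃ_{X/k} = ⋀ᵃ Ω¹_{X/k}` (`Motives.hodgeSheaf X a`) are locally free of rank `C(d, a)`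
(`Motives.hasRank_hodgeSheaf_choose_holds`, Hartshorne II Ex. 5.16(a) with II.8.15 / Stacks 02G1;
repackaged as `hasRank_hodgeSheaf`, `hasRankLE_hodgeSheaf`, `isVectorBundle_hodgeSheaf`; finite
local freeness `Crystalline.isFiniteLocallyFree_hodgeSheaf` / `…_cotangentSheaf` is in
`Crystalline/HodgeSheavesTorsionFree`). Hence, by "mono is local on the base"
(`Modules/LocallyFreeTorsionFree`, `Modules.mono_zsmul_id_of_isFiniteLocallyFree`), in the
`𝒪_X`-MODULE form `Mono (m • 𝟙 M)` in `X.Modules` (the abelian-sheaf forms, marked `toSheaf`,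
follow by `SheafOfModules.mono_zsmul_id_iff_mono_zsmul_id_toSheaf`):

* `mono_zsmul_id_hodgeSheaf`, `mono_zsmul_id_toSheaf_hodgeSheaf`,
  `hodgeSheaf_eq_zero_of_zsmul_eq_zero`, `mono_zsmul_id_cotangentSheaf`,
  `mono_zsmul_id_toSheaf_cotangentSheaf` — if no ring of sections `Γ(X, U)` has `m`-torsion
  (`m : ℤ`), then `m • 𝟙 Ωᵃ` is a monomorphism of `𝒪_X`-modules, `m • 𝟙` is a monomorphism of the
  abelian sheaf underlying `Ωᵃ` (the sheaf whose `Sheaf.H` is `Motives.hodgeCohomology X a b`), no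
  section of `Ωᵃ` is killed by `m`, and the same for `Ω¹ = cotangentSheaf X`;
* `mono_zsmul_id_hodgeSheaf_of_isRegular`, … — the hypothesis holds for `m` regular in `k`, as a
  smooth morphism is flat (Mathlib) and the sections of a flat `k`-scheme have no torsion by regular
  elements of `k` (`Modules/FlatSectionsRegular`, Stacks 00HI);
* `mono_p_smul_id_hodgeSheaf_witt`, `mono_p_smul_id_cotangentSheaf_witt`,
  `mono_p_smul_id_unit_witt`, `mono_p_smul_id_unit_of_flat_witt` — **the `p`-adic case**: for `𝒳`
  smooth of relative dimension `d` over the Witt vectors `W(k)` of a domain `k` of characteristic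
  `p` (`p ≠ 0` in the domain `W(k)`), `𝒪_𝒳`, `Ω¹_{𝒳/W}` and all `Ωᵃ_{𝒳/W}` have NO `p`-TORSION
  AS SHEAVES OF MODULES: `Mono ((p : ℤ) • 𝟙 _)` in `𝒳.left.Modules`. This is the standing
  hypothesis "`Ωʲ_𝒳` is `p`-torsion free" of the staircase complexes
  `p(r)Ω•_{X_N} : p^{(r-j)M} Ωʲ_{X_{(r-j)N}}` of X. Hu, arXiv:2507.12458, Def. 8.2 (and of
  Bloch–Esnault–Kerz 2014, §8), consumed in the categorical form `[Mono ((q : ℤ) • 𝟙 T)]` by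
  `Algebra/Homology/StaircaseComplexes`, `StaircaseTorsionFree`, `ExtCokernelBockstein`; the
  abelian-sheaf forms `Mono ((p : ℤ) • 𝟙 ((SheafOfModules.toSheaf _).obj _))` for `[Field k]`
  are `Crystalline.mono_p_smul_id_hodgeSheaf`, `Crystalline.mono_p_smul_id_cotangentSheaf`,
  `Crystalline.mono_p_smul_id_structureSheaf` of `Crystalline/HodgeSheavesTorsionFree`;
* `mono_zsmul_id_of_isVectorBundle`, `mono_zsmul_id_unit_of_torsionFree` — the general statements
  for vector bundles (`Motives.IsVectorBundle` = Mathlib `IsLocallyFree ∧ IsFiniteType`, equivalent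
  to `IsFiniteLocallyFree` by `Modules/VectorBundleFiniteLocallyFree`) and for `𝒪_X`.

[folklore] Everything is proved; no named facts (the inputs `hasRank_hodgeSheaf_choose_holds`,
`Modules.eq_zero_of_zsmul_eq_zero` are discharged / proved in the tree). NOT here: torsion-freeness
of the COHOMOLOGY groups `Hᵇ(𝒳, Ωᵃ)` (a hypothesis of Hu's theorem, not a consequence of
smoothness); the thickenings `X_N = 𝒳 ⊗ W/p^N` and the complexes themselves.
-/

namespace Literature.AlgebraicGeometry.Motives

open _root_.CategoryTheory _root_.CategoryTheory.Limits Opposite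
open _root_.AlgebraicGeometry
open Literature.AlgebraicGeometry.Modules

universe u

/-! ### Vector bundles -/

section VectorBundle

variable {Y : Scheme.{u}}

/-- **A vector bundle over torsion-free rings of sections is torsion-free**: for `E` a vector
bundle on a scheme `Y` (`IsVectorBundle`: locally free of finite type) and `m : ℤ` killing no
nonzero section of `𝒪_Y`, `m • 𝟙 E` is a monomorphism. [folklore] -/
theorem mono_zsmul_id_of_isVectorBundle {E : Y.Modules} (hE : IsVectorBundle E) (m : ℤ)
    (h : ∀ (U : Y.Opens) (r : Γ(Y, U)), m • r = 0 → r = 0) : Mono (m • 𝟙 E) :=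
  mono_zsmul_id_of_isFiniteLocallyFree hE.isFiniteLocallyFree m h

/-- `m`-torsion-freeness of the rings of sections is `Mono (m • 𝟙 𝒪_Y)` for the structure sheaf
`𝒪_Y = SheafOfModules.unit` as an `𝒪_Y`-module. [folklore] -/
theorem mono_zsmul_id_unit_of_torsionFree (Y : Scheme.{u}) (m : ℤ)
    (h : ∀ (U : Y.Opens) (r : Γ(Y, U)), m • r = 0 → r = 0) :
    Mono (m • 𝟙 (SheafOfModules.unit Y.ringCatSheaf : Y.Modules)) :=
  (schemeModules_mono_zsmul_id_iff_of_iso_unit _ (Iso.refl _) m).mpr h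

end VectorBundle

/-! ### The Hodge sheaves of a smooth `k`-scheme -/

section Smooth

variable {k : Type u} [CommRing k] (X : Over (Spec (CommRingCat.of k))) (d : ℕ)
  [SmoothOfRelativeDimension d X.hom]

include d

/-- For `X → Spec k` smooth of relative dimension `d`, `Ωᵃ_{X/k}` has rank `C(d, a)`
(`Motives.HasRank`; this is `hasRank_hodgeSheaf_choose_holds`, repackaged). [folklore] -/
theorem hasRank_hodgeSheaf (a : ℕ) : HasRank (hodgeSheaf X a) (d.choose a) := by
  obtain ⟨q, hq, hr⟩ := hasRank_hodgeSheaf_choose_holds X d a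
  exact ⟨q, hq, hr⟩

/-- For `X → Spec k` smooth of relative dimension `d`, `Ωᵃ_{X/k}` has rank `≤ C(d, a)`.
[folklore] -/
theorem hasRankLE_hodgeSheaf (a : ℕ) : HasRankLE (hodgeSheaf X a) (d.choose a) :=
  (hasRank_hodgeSheaf X d a).hasRankLE

/-- For `X → Spec k` smooth of relative dimension `d`, every `Ωᵃ_{X/k}` is a vector bundle
(`Motives.IsVectorBundle`). [folklore] -/
theorem isVectorBundle_hodgeSheaf (a : ℕ) : IsVectorBundle (hodgeSheaf X a) :=
  (hasRankLE_hodgeSheaf X d a).isVectorBundle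

/-- For `X → Spec k` smooth of relative dimension `d`, `Ω¹_{X/k} = cotangentSheaf X` is a vector
bundle. [folklore] -/
theorem isVectorBundle_cotangentSheaf : IsVectorBundle (cotangentSheaf X) :=
  (Crystalline.isFiniteLocallyFree_cotangentSheaf X d).isVectorBundle

variable (m : ℤ) (h : ∀ (U : X.left.Opens) (r : Γ(X.left, U)), m • r = 0 → r = 0)

include h

/-- **`Ωᵃ_{X/k}` has no more torsion than `𝒪_X`**: for `X → Spec k` smooth of relative dimension
`d` and `m : ℤ` such that no ring of sections `Γ(X, U)` has `m`-torsion, `m • 𝟙 Ωᵃ_{X/k}` is a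
monomorphism of `𝒪_X`-modules. [folklore] -/
theorem mono_zsmul_id_hodgeSheaf (a : ℕ) : Mono (m • 𝟙 (hodgeSheaf X a)) :=
  mono_zsmul_id_of_isFiniteLocallyFree (Crystalline.isFiniteLocallyFree_hodgeSheaf X d a) m h

/-- The same for the abelian sheaf underlying `Ωᵃ_{X/k}` (the sheaf `(SheafOfModules.toSheaf _).obj
(hodgeSheaf X a)` whose `Sheaf.H` is `hodgeCohomology X a b`). [folklore] -/
theorem mono_zsmul_id_toSheaf_hodgeSheaf (a : ℕ) :
    Mono (m • 𝟙 ((SheafOfModules.toSheaf X.left.ringCatSheaf).obj (hodgeSheaf X a))) :=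
  (SheafOfModules.mono_zsmul_id_iff_mono_zsmul_id_toSheaf (R := X.left.ringCatSheaf)
    (hodgeSheaf X a) m).mp (mono_zsmul_id_hodgeSheaf X d m h a)

/-- Sectionwise: no section of `Ωᵃ_{X/k}` over any open is killed by `m`. [folklore] -/
theorem hodgeSheaf_eq_zero_of_zsmul_eq_zero (a : ℕ) (U : X.left.Opens)
    (s : Γ(hodgeSheaf X a, U)) (hs : m • s = 0) : s = 0 :=
  (schemeModules_mono_zsmul_id_iff_torsionFree (hodgeSheaf X a) m).mp
    (mono_zsmul_id_hodgeSheaf X d m h a) U s hs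

/-- **`Ω¹_{X/k}` has no more torsion than `𝒪_X`** (`X → Spec k` smooth of relative dimension `d`).
[folklore] -/
theorem mono_zsmul_id_cotangentSheaf : Mono (m • 𝟙 (cotangentSheaf X)) :=
  (mono_zsmul_id_iff_of_iso m (hodgeSheafOneIso X)).mp (mono_zsmul_id_hodgeSheaf X d m h 1)

/-- The same for the abelian sheaf underlying `Ω¹_{X/k}` (whose `Sheaf.H` is
`hodgeCohomologyOne X b`). [folklore] -/
theorem mono_zsmul_id_toSheaf_cotangentSheaf :
    Mono (m • 𝟙 ((SheafOfModules.toSheaf X.left.ringCatSheaf).obj (cotangentSheaf X))) :=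
  (SheafOfModules.mono_zsmul_id_iff_mono_zsmul_id_toSheaf (R := X.left.ringCatSheaf)
    (cotangentSheaf X) m).mp (mono_zsmul_id_cotangentSheaf X d m h)

/-- Sectionwise: no section of `Ω¹_{X/k}` over any open is killed by `m`. [folklore] -/
theorem cotangentSheaf_eq_zero_of_zsmul_eq_zero (U : X.left.Opens)
    (s : Γ(cotangentSheaf X, U)) (hs : m • s = 0) : s = 0 :=
  (schemeModules_mono_zsmul_id_iff_torsionFree (cotangentSheaf X) m).mp
    (mono_zsmul_id_cotangentSheaf X d m h) U s hs

end Smooth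

/-! ### Smooth over `k`, `m` regular in `k` -/

section Regular

variable {k : Type u} [CommRing k] (X : Over (Spec (CommRingCat.of k))) (d : ℕ)
  [SmoothOfRelativeDimension d X.hom] (m : ℤ) (hm : IsRegular (m : k))

include d hm

/-- For `X → Spec k` smooth (hence flat) and `m` regular in `k`, no ring of sections `Γ(X, U)`
has `m`-torsion (`Modules.eq_zero_of_zsmul_eq_zero`, Stacks 00HI). [folklore] -/
theorem sections_eq_zero_of_zsmul_eq_zero_of_isRegular (U : X.left.Opens) (r : Γ(X.left, U))
    (hr : m • r = 0) : r = 0 :=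
  haveI : Smooth X.hom := SmoothOfRelativeDimension.smooth d X.hom
  eq_zero_of_zsmul_eq_zero X.hom m hm U r hr

/-- For `X → Spec k` smooth of relative dimension `d` and `m` regular in `k`: `m • 𝟙 𝒪_X` is a
monomorphism of `𝒪_X`-modules. [folklore] -/
theorem mono_zsmul_id_unit_of_isRegular :
    Mono (m • 𝟙 (SheafOfModules.unit X.left.ringCatSheaf : X.left.Modules)) :=
  mono_zsmul_id_unit_of_torsionFree X.left m
    (sections_eq_zero_of_zsmul_eq_zero_of_isRegular X d m hm)

/-- For `X → Spec k` smooth of relative dimension `d` and `m` regular in `k`: `m • 𝟙 Ωᵃ_{X/k}`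
is a monomorphism for every `a`. [folklore] -/
theorem mono_zsmul_id_hodgeSheaf_of_isRegular (a : ℕ) : Mono (m • 𝟙 (hodgeSheaf X a)) :=
  mono_zsmul_id_hodgeSheaf X d m (sections_eq_zero_of_zsmul_eq_zero_of_isRegular X d m hm) a

/-- The same for the abelian sheaf underlying `Ωᵃ_{X/k}`. [folklore] -/
theorem mono_zsmul_id_toSheaf_hodgeSheaf_of_isRegular (a : ℕ) :
    Mono (m • 𝟙 ((SheafOfModules.toSheaf X.left.ringCatSheaf).obj (hodgeSheaf X a))) :=
  mono_zsmul_id_toSheaf_hodgeSheaf X d m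
    (sections_eq_zero_of_zsmul_eq_zero_of_isRegular X d m hm) a

/-- Sectionwise, for `m` regular in `k`: no section of `Ωᵃ_{X/k}` is killed by `m`. [folklore] -/
theorem hodgeSheaf_eq_zero_of_zsmul_eq_zero_of_isRegular (a : ℕ) (U : X.left.Opens)
    (s : Γ(hodgeSheaf X a, U)) (hs : m • s = 0) : s = 0 :=
  hodgeSheaf_eq_zero_of_zsmul_eq_zero X d m
    (sections_eq_zero_of_zsmul_eq_zero_of_isRegular X d m hm) a U s hs

/-- For `X → Spec k` smooth of relative dimension `d` and `m` regular in `k`: `m • 𝟙 Ω¹_{X/k}` is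
a monomorphism. [folklore] -/
theorem mono_zsmul_id_cotangentSheaf_of_isRegular : Mono (m • 𝟙 (cotangentSheaf X)) :=
  mono_zsmul_id_cotangentSheaf X d m (sections_eq_zero_of_zsmul_eq_zero_of_isRegular X d m hm)

/-- The same for the abelian sheaf underlying `Ω¹_{X/k}`. [folklore] -/
theorem mono_zsmul_id_toSheaf_cotangentSheaf_of_isRegular :
    Mono (m • 𝟙 ((SheafOfModules.toSheaf X.left.ringCatSheaf).obj (cotangentSheaf X))) :=
  mono_zsmul_id_toSheaf_cotangentSheaf X d m
    (sections_eq_zero_of_zsmul_eq_zero_of_isRegular X d m hm)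

end Regular

/-! ### The `p`-adic case: `𝒳` smooth over `W(k)` -/

section Witt

variable {p : ℕ} [Fact p.Prime] {k : Type u} [CommRing k] [IsDomain k] [CharP k p]
  (𝒳 : Over (Spec (CommRingCat.of (WittVector p k))))

/-- **`𝒪_𝒳` has no `p`-torsion** for `𝒳` flat (e.g. smooth) over `W(k)`, `k` a domain of
characteristic `p`: `(p : ℤ) • 𝟙 𝒪_𝒳` is a monomorphism of `𝒪_𝒳`-modules (the abelian-sheaf
form is `Modules.mono_p_smul_id_structureSheaf_of_flat_witt`). [folklore] -/
theorem mono_p_smul_id_unit_of_flat_witt [Flat 𝒳.hom] :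
    Mono ((p : ℤ) • 𝟙 (SheafOfModules.unit 𝒳.left.ringCatSheaf : 𝒳.left.Modules)) :=
  mono_zsmul_id_unit_of_torsionFree 𝒳.left (p : ℤ) (eq_zero_of_p_smul_eq_zero_of_flat_witt 𝒳.hom)

variable (d : ℕ) [SmoothOfRelativeDimension d 𝒳.hom]

include d

/-- **`Ωᵃ_{𝒳/W}` has no `p`-torsion (as a sheaf of modules)** for `𝒳 → Spec W(k)` smooth of
relative dimension `d`: `(p : ℤ) • 𝟙 Ωᵃ_{𝒳/W}` is a monomorphism of `𝒪_𝒳`-modules, for every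
`a` — the hypothesis "`Ωʲ_𝒳` is `p`-torsion free" of X. Hu, arXiv:2507.12458, Def. 8.2
(abelian-sheaf form for `k` a field: `Crystalline.mono_p_smul_id_hodgeSheaf`). [folklore] -/
theorem mono_p_smul_id_hodgeSheaf_witt (a : ℕ) : Mono ((p : ℤ) • 𝟙 (hodgeSheaf 𝒳 a)) :=
  mono_zsmul_id_hodgeSheaf_of_isRegular 𝒳 d (p : ℤ) (WittVector.isRegular_intCast_p p k) a

/-- **`Ω¹_{𝒳/W}` has no `p`-torsion (as a sheaf of modules)** for `𝒳 → Spec W(k)` smooth of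
relative dimension `d`. [folklore] -/
theorem mono_p_smul_id_cotangentSheaf_witt : Mono ((p : ℤ) • 𝟙 (cotangentSheaf 𝒳)) :=
  mono_zsmul_id_cotangentSheaf_of_isRegular 𝒳 d (p : ℤ) (WittVector.isRegular_intCast_p p k)

/-- **`𝒪_𝒳` has no `p`-torsion (as a sheaf of modules)** for `𝒳 → Spec W(k)` smooth of relative
dimension `d`. [folklore] -/
theorem mono_p_smul_id_unit_witt :
    Mono ((p : ℤ) • 𝟙 (SheafOfModules.unit 𝒳.left.ringCatSheaf : 𝒳.left.Modules)) :=
  mono_zsmul_id_unit_of_isRegular 𝒳 d (p : ℤ) (WittVector.isRegular_intCast_p p k)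

end Witt

end Literature.AlgebraicGeometry.Motives
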